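import Literature.AlgebraicGeometry.Motives.HodgeStructureLefschetzGroupCenterFieldExtension
import HarnessLib

/-!
# THE CENTRE OF MILNE'S SIMILITUDE GROUP `G(A)` (§4: `G(A)(R) = {γ ∈ C(A) ⊗ R | γ†γ ∈ R^×}`) ON `K`-POINTS AND ALONG `K → L`:
# `Z(G(H)(K)) = G(H)(K) ∩ (E_φ ⊗ K) = G(H)(K) ∩ Z(C(H)(K))`, `Z(S(H)(K)) = S(H)(K) ∩ Z(G(H)(K))`, `K^× ⊆ Z(G(H)(K))`, FIRST KIND
# `γ² = ν · 1` FOR CENTRAL `γ`, AND `γ_L ∈ Z(G(H)(L)) ⟺ γ ∈ Z(G(H)(K))` (Milne 1999 §4 p. 659, §1 Remark 1.2 ∕ 1.6, §3 p. 653)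

[topic AlgebraicGeometry/Motives]

Layer `Literature/AlgebraicGeometry/Motives`, lane `lit-hodgefound` (Track 2 foundations library; prover seat
`lit-hodgefound-p02`, generation 56, self-proposed row g56-#8). THEOREMS ONLY: no definition, no named fact (net debt `0`),
no instance, no notation.  Milne §4 (p. 659) introduces, next to `S(A)`, the group `G(A)` of `γ ∈ C(A) ⊗ R` with `γ†γ ∈ R^×`
(«the largest algebraic subgroup of `GSp(E^D)` commuting with the endomorphisms of `A`»; in the tree `G(H)(K) =
Polarization.lefschetzSimilitudeGroupBaseChange K`, `Motives/HodgeStructureLefschetzGroupPoints`, with `S(H)(K) ≤ G(H)(K)`, the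
scalars `K^×` inside, and Remark 1.6 on points `G(H)(K) = (γ ↦ γ_L)⁻¹ G(H)(L)`, `Motives/HodgeStructureLefschetzGroupFieldExtension`).
Its CENTRE was not in the tree.  PROVED here, by the mechanism of g54-#4 (for `S`) and g56-#2 (along `K → L`), for every
polarized `ℚ`-Hodge structure `(H, ψ)` on a finite-dimensional `V` and fields `ℚ ⊆ K ⊆ L`:
(i) **`γ ∈ G(H)(K)` IS CENTRAL IFF `↑γ ∈ E_φ ⊗ K`** (`G ⊇ S` and `K[S(H)(K)] = C(H)(K)` — «`C(A)` is generated by `S(A)(k)`», §3 —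
so a central `γ` commutes with `C(H)(K)`, i.e. lies in `Z_{End}(C(H)(K)) = E_φ ⊗ K` by Remark 1.2 on points; conversely
`G(H)(K) ⊆ C(H)(K)`); equivalently `↑γ ∈ Z(C(H)(K)) = C₀ ⊗ K`; hence `Z(S(H)(K)) = S(H)(K) ∩ Z(G(H)(K))` and `K^× · 1 ⊆ Z(G(H)(K))`;
(ii) FIRST KIND: a central `γ ∈ G(H)(K)` satisfies `γ² = ν · 1`, `ν ∈ K^×` its multiplier (`↑γ ∈ C₀ ⊗ K` is `†_K`-fixed, g54-#6,
and `γ†γ = ν`);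
(iii) ALONG `K → L`: `γ ∈ Z(G(H)(K)) ⟹ γ_L ∈ Z(G(H)(L))` (LEMMA A of g56-#1 on `↑γ ∈ E_φ ⊗ K`) and conversely (injectivity of
`γ ↦ γ_L`), so `Z(G(H)(K))` is the preimage of `Z(G(H)(L))`, with an injective homomorphism `Z(G(H)(K)) →* Z(G(H)(L))`.

## The sources, verbatim

* J. S. Milne, *Lefschetz classes on abelian varieties*, Duke Math. J. 96 (1999) 639–675 [Milne1999LefschetzClasses] (held
  `paper:doi-10-1215-s0012-7094-99-09620-5`): §4 p. 659 L10–L20 «`G(A)(R) = {γ ∈ C(A) ⊗ R | γ†γ ∈ R^×}` … Thus, for any ample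
  divisor `D` on `A`, `G(A)` is the largest algebraic subgroup of `GSp(E^D)` commuting with the endomorphisms of `A`», L28–L34 («the
  kernel of `l(A)` … equals `S(A)`», «`a ↦ (a⁻¹, a⁻²) : 𝔾_m → L(A)`»); §1 Remark 1.2 (p. 643: «`C(A)` is the centralizer of
  `End⁰(A) ⊗ k` in `End(V(A))`, and `End(V(A))` is the centralizer of `C(A)`»), Remark 1.6 (p. 644), p. 645 L2–L6 (`C₀`); §3
  p. 653 («the `k`-algebra `C(A)` is generated by `S(A)(k)`»).
* P. Deligne, *Hodge cycles on abelian varieties*, LNM 900 (1982) [Deligne1982HodgeCycles], I §3.1.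
* Yu. G. Zarhin, *Superelliptic Jacobians* [Zarhin2018SuperellipticJacobians], §4 Thm. 4.1 (double centralizer in a central simple algebra).

Nearest tree results, BY NAME: `Polarization.lefschetzSimilitudeGroupBaseChange`, `mem_lefschetzSimilitudeGroupBaseChange_iff`,
`lefschetzGroupBaseChange_le_lefschetzSimilitudeGroupBaseChange`, `smulOfUnit_mem_lefschetzSimilitudeGroupBaseChange`
(`Motives/HodgeStructureLefschetzGroupPoints`); `mem_lefschetzSimilitudeGroupBaseChange_iff_adjointBaseChange_mul_self_eq_smul`
(`Motives/HodgeStructurePolarizationAdjointPoints`); `Polarization.glExtendScalars_mem_lefschetzSimilitudeGroupBaseChange_iff`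
(`Motives/HodgeStructureLefschetzGroupFieldExtension`); `Polarization.adjoin_coe_lefschetzGroupBaseChange_eq_centralizer_endAlg_baseChange`
(`Motives/HodgeStructureCentralizerGeneratedByLefschetzGroup`); g54-#2 `centralizer_centralizer_endAlg_baseChange_eq_adjoin`,
`mem_adjoin_baseChange_endAlg_iff_mem_span'`, `mem_center_centralizer_endAlg_baseChange_iff`; g54-#4 (the same for `S`); g54-#6
`Polarization.forall_center_adjointBaseChange_eq_self_iff`; g56-#1 `mem_span_image_baseChange_of_extendScalars_comm`; g56-#2
`coe_glExtendScalars_extendScalars`, `glExtendScalars_injective`.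

## Dictionary and what is proved (namespace `Literature.AlgebraicGeometry.Motives.HodgeStructure`)

`G(H)(K) = ψ.lefschetzSimilitudeGroupBaseChange K`, `S(H)(K) = ψ.lefschetzGroupBaseChange K`, `γ_L = glExtendScalars K L V γ`,
`Z(·) = Subgroup.center`, `E_φ ⊗ K = K[a_K | a ∈ E_φ]`.

* §1 `K`-points: `Polarization.coe_mem_centralizer_endAlg_baseChange_of_mem_lefschetzSimilitudeGroupBaseChange`,
  **`Polarization.mem_center_lefschetzSimilitudeGroupBaseChange_iff`** (`↑γ ∈ E_φ ⊗ K`), **`…_iff_mem_span`**,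
  **`…_iff_mem_center_centralizer`** (`↑γ ∈ Z(C(H)(K))`), **`Polarization.mem_center_lefschetzGroupBaseChange_iff_inclusion_mem_center`**
  (`Z(S) = S ∩ Z(G)`), **`Polarization.smulOfUnit_mem_center_lefschetzSimilitudeGroupBaseChange`** (`K^× ⊆ Z(G)`),
  **`Polarization.exists_coe_mul_coe_eq_smul_one_of_mem_center_lefschetzSimilitudeGroupBaseChange`** (first kind: `γ² = ν · 1`).
* §2 along `K → L`: **`Polarization.glExtendScalars_mem_center_lefschetzSimilitudeGroupBaseChange`**, **`…_iff`**,
  **`Polarization.comap_center_lefschetzSimilitudeGroupBaseChange_eq_center`**,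
  **`Polarization.exists_center_lefschetzSimilitudeGroupBaseChange_monoidHom_injective`**.
-/

noncomputable section

open scoped TensorProduct

namespace Literature.AlgebraicGeometry.Motives

namespace HodgeStructure

universe u u' v

section Points

variable (K : Type u) [Field K] [Algebra ℚ K] {V : Type v} [AddCommGroup V] [Module ℚ V] [Module.Finite ℚ V] {n : ℤ}
  {H : HodgeStructure V n} (ψ : Polarization H)

omit [Module.Finite ℚ V] in
/-- The commutant of a set is the commutant of the algebra it generates. [folklore] -/
private theorem centralizer_coe_adjoin_eq₅₆₈ {R : Type*} {A : Type*} [CommSemiring R] [Semiring A] [Algebra R A]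
    (s : Set A) : Subalgebra.centralizer R (Algebra.adjoin R s : Set A) = Subalgebra.centralizer R s := by
  refine le_antisymm (fun z hz => ?_) (fun z hz => ?_)
  · rw [Subalgebra.mem_centralizer_iff] at hz ⊢
    exact fun g hg => hz g (Algebra.subset_adjoin hg)
  · rw [Subalgebra.mem_centralizer_iff] at hz ⊢
    intro g hg
    have hle : Algebra.adjoin R s ≤ Subalgebra.centralizer R {z} := Algebra.adjoin_le fun x hx => by
      rw [SetLike.mem_coe, Subalgebra.mem_centralizer_iff]
      intro y hy
      rw [Set.mem_singleton_iff.1 hy]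
      exact (hz x hx).symm
    exact ((Subalgebra.mem_centralizer_iff R).1 (hle hg) z rfl).symm

omit [Module.Finite ℚ V] in
/-- **`↑γ ∈ C(H)(K)` for `γ ∈ G(H)(K)`** («`γ ∈ C(A) ⊗ R`»). [cite: Milne1999LefschetzClasses, §4 p. 659 L10–L14] -/
theorem Polarization.coe_mem_centralizer_endAlg_baseChange_of_mem_lefschetzSimilitudeGroupBaseChange
    {γ : (K ⊗[ℚ] V) ≃ₗ[K] (K ⊗[ℚ] V)} (hγ : γ ∈ ψ.lefschetzSimilitudeGroupBaseChange K) :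
    (γ : Module.End K (K ⊗[ℚ] V)) ∈
      Subalgebra.centralizer K ((fun a : Module.End ℚ V => a.baseChange K) '' (H.endAlg : Set (Module.End ℚ V))) := by
  rw [Subalgebra.mem_centralizer_iff]
  rintro _ ⟨a, ha, rfl⟩
  exact LinearMap.ext fun x => ((ψ.mem_lefschetzSimilitudeGroupBaseChange_iff γ).1 hγ).1 ⟨a, ha⟩ x

/-! ## §1 `K`-points: `Z(G(H)(K)) = G(H)(K) ∩ (E_φ ⊗ K) = G(H)(K) ∩ Z(C(H)(K)) = G(H)(K) ∩ (C₀ ⊗ K)` -/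

/-- **AN ELEMENT OF MILNE'S `G(A)(K)` IS CENTRAL IFF IT LIES IN `End⁰(A) ⊗ K`**: `γ ∈ G(H)(K)` commutes with all of `G(H)(K)` iff
`↑γ ∈ E_φ ⊗ K = K[a_K | a ∈ E_φ]` — `⟹`: `γ` commutes with `S(H)(K) ≤ G(H)(K)`, which generates the `K`-algebra `C(H)(K)` («the
`k`-algebra `C(A)` is generated by the `γ ∈ S(A)(k)`», the tree's `adjoin_coe_lefschetzGroupBaseChange_eq_centralizer_endAlg_baseChange`),
so `↑γ ∈ Z_{End}(C(H)(K)) = E_φ ⊗ K` (Remark 1.2 on `K`-points, g54-#2); `⟸`: `G(H)(K) ⊆ C(H)(K)` commutes with `E_φ ⊗ K`.  The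
same mechanism as for `S` (g54-#4). [cite: Milne1999LefschetzClasses, §4 p. 659 L10–L20 (G(A)), §1 Remark 1.2 (p. 643) and §3 p. 653] -/
theorem Polarization.mem_center_lefschetzSimilitudeGroupBaseChange_iff (γ : ψ.lefschetzSimilitudeGroupBaseChange K) :
    γ ∈ Subgroup.center (ψ.lefschetzSimilitudeGroupBaseChange K) ↔
      ((γ : (K ⊗[ℚ] V) ≃ₗ[K] (K ⊗[ℚ] V)) : Module.End K (K ⊗[ℚ] V)) ∈
        Algebra.adjoin K (Set.range fun a : H.endAlg => (a : Module.End ℚ V).baseChange K) := by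
  rw [Subgroup.mem_center_iff, ← centralizer_centralizer_endAlg_baseChange_eq_adjoin K H ⟨ψ⟩,
    ← ψ.adjoin_coe_lefschetzGroupBaseChange_eq_centralizer_endAlg_baseChange K, centralizer_coe_adjoin_eq₅₆₈,
    Subalgebra.mem_centralizer_iff]
  constructor
  · rintro h _ ⟨δ, hδ, rfl⟩
    have hδγ := congrArg (fun ε : ψ.lefschetzSimilitudeGroupBaseChange K => ((ε : (K ⊗[ℚ] V) ≃ₗ[K] (K ⊗[ℚ] V)) :
      Module.End K (K ⊗[ℚ] V))) (h ⟨δ, ψ.lefschetzGroupBaseChange_le_lefschetzSimilitudeGroupBaseChange K hδ⟩)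
    simpa only [Subgroup.coe_mul, LinearEquiv.coe_toLinearMap_mul] using hδγ
  · intro h δ
    -- `↑γ` commutes with `C(H)(K) ∋ ↑δ`
    have hγC : ((γ : (K ⊗[ℚ] V) ≃ₗ[K] (K ⊗[ℚ] V)) : Module.End K (K ⊗[ℚ] V)) ∈ Subalgebra.centralizer K
        ((Subalgebra.centralizer K ((fun a : Module.End ℚ V => a.baseChange K) '' (H.endAlg : Set (Module.End ℚ V)))) :
          Set (Module.End K (K ⊗[ℚ] V))) := by
      rw [← ψ.adjoin_coe_lefschetzGroupBaseChange_eq_centralizer_endAlg_baseChange K, centralizer_coe_adjoin_eq₅₆₈,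
        Subalgebra.mem_centralizer_iff]
      exact h
    have hδC := ψ.coe_mem_centralizer_endAlg_baseChange_of_mem_lefschetzSimilitudeGroupBaseChange K δ.2
    refine Subtype.ext (LinearEquiv.toLinearMap_injective ?_)
    rw [Subgroup.coe_mul, Subgroup.coe_mul, LinearEquiv.coe_toLinearMap_mul, LinearEquiv.coe_toLinearMap_mul]
    exact (Subalgebra.mem_centralizer_iff K).1 hγC _ hδC

/-- The same in the span spelling `E_φ ⊗ K = span_K {a_K | a ∈ E_φ}`. [cite: Milne1999LefschetzClasses, §4 p. 659 L10–L20 and §1 Remark 1.2 (p. 643)] -/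
theorem Polarization.mem_center_lefschetzSimilitudeGroupBaseChange_iff_mem_span (γ : ψ.lefschetzSimilitudeGroupBaseChange K) :
    γ ∈ Subgroup.center (ψ.lefschetzSimilitudeGroupBaseChange K) ↔
      ((γ : (K ⊗[ℚ] V) ≃ₗ[K] (K ⊗[ℚ] V)) : Module.End K (K ⊗[ℚ] V)) ∈
        Submodule.span K (Set.range fun a : H.endAlg => (a : Module.End ℚ V).baseChange K) := by
  rw [ψ.mem_center_lefschetzSimilitudeGroupBaseChange_iff K γ, mem_adjoin_baseChange_endAlg_iff_mem_span' K H ⟨ψ⟩]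

set_option maxSynthPendingDepth 4 in
/-- **`Z(G(H)(K)) = G(H)(K) ∩ Z(C(H)(K))`**: `γ ∈ G(H)(K)` is central in the GROUP `G(H)(K)` iff `↑γ` is central in the ALGEBRA
`C(H)(K)` — the group of similitudes of `(C(A) ⊗ K, †)` has centre `G ∩ Z(C(A) ⊗ K) = G ∩ (C₀ ⊗ K)`.
[cite: Milne1999LefschetzClasses, §4 p. 659 L10–L20 and §1 p. 645 L2–L6 (`C₀`)] -/
theorem Polarization.mem_center_lefschetzSimilitudeGroupBaseChange_iff_mem_center_centralizer
    (γ : ψ.lefschetzSimilitudeGroupBaseChange K) :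
    γ ∈ Subgroup.center (ψ.lefschetzSimilitudeGroupBaseChange K) ↔
      (⟨((γ : (K ⊗[ℚ] V) ≃ₗ[K] (K ⊗[ℚ] V)) : Module.End K (K ⊗[ℚ] V)),
          ψ.coe_mem_centralizer_endAlg_baseChange_of_mem_lefschetzSimilitudeGroupBaseChange K γ.2⟩ :
          Subalgebra.centralizer K ((fun a : Module.End ℚ V => a.baseChange K) '' (H.endAlg : Set (Module.End ℚ V)))) ∈
        Subalgebra.center K (Subalgebra.centralizer K
          ((fun a : Module.End ℚ V => a.baseChange K) '' (H.endAlg : Set (Module.End ℚ V)))) := by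
  rw [ψ.mem_center_lefschetzSimilitudeGroupBaseChange_iff K γ, mem_center_centralizer_endAlg_baseChange_iff K H ⟨ψ⟩]

/-- **`Z(S(H)(K)) = S(H)(K) ∩ Z(G(H)(K))`**: an element of `S(H)(K)` is central in `S(H)(K)` iff it is central in the larger
`G(H)(K)` (both mean `↑γ ∈ E_φ ⊗ K`, g54-#4). [cite: Milne1999LefschetzClasses, §4 p. 659 L10–L20 and L28–L31] -/
theorem Polarization.mem_center_lefschetzGroupBaseChange_iff_inclusion_mem_center (γ : ψ.lefschetzGroupBaseChange K) :
    γ ∈ Subgroup.center (ψ.lefschetzGroupBaseChange K) ↔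
      Subgroup.inclusion (ψ.lefschetzGroupBaseChange_le_lefschetzSimilitudeGroupBaseChange K) γ ∈
        Subgroup.center (ψ.lefschetzSimilitudeGroupBaseChange K) := by
  rw [ψ.mem_center_lefschetzGroupBaseChange_iff_mem_span K γ, ψ.mem_center_lefschetzSimilitudeGroupBaseChange_iff_mem_span K]
  rfl

omit [Module.Finite ℚ V] in
/-- **THE SCALARS `K^× · 1` ARE CENTRAL IN `G(H)(K)`** (`c · 1 = (c · 1_{E_φ})_K ∈ E_φ ⊗ K`; «`a ↦ (a⁻¹, a⁻²) : 𝔾_m → L(A)`»).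
[cite: Milne1999LefschetzClasses, §4 p. 659 L31–L34] -/
theorem Polarization.smulOfUnit_mem_center_lefschetzSimilitudeGroupBaseChange (c : Kˣ) :
    (⟨LinearEquiv.smulOfUnit c, ψ.smulOfUnit_mem_lefschetzSimilitudeGroupBaseChange K c⟩ : ψ.lefschetzSimilitudeGroupBaseChange K) ∈
      Subgroup.center (ψ.lefschetzSimilitudeGroupBaseChange K) := by
  rw [Subgroup.mem_center_iff]
  intro δ
  refine Subtype.ext (LinearEquiv.ext fun x => ?_)
  change (δ : (K ⊗[ℚ] V) ≃ₗ[K] (K ⊗[ℚ] V)) ((c : K) • x) = (c : K) • (δ : (K ⊗[ℚ] V) ≃ₗ[K] (K ⊗[ℚ] V)) x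
  rw [map_smul]

set_option maxSynthPendingDepth 4 in
/-- **FIRST KIND: A CENTRAL `γ ∈ G(H)(K)` HAS `γ² = ν · 1` WITH `ν ∈ K^×` ITS MULTIPLIER** — `↑γ ∈ C₀ ⊗ K` is `†_K`-fixed (g54-#6) and
`γ†γ = ν · 1` («`G(A)(R) = {γ ∈ C(A) ⊗ R | γ†γ ∈ R^×}`»). [cite: Milne1999LefschetzClasses, §4 p. 659 L10–L14, §1 p. 645 L2–L6 and Remark 1.6] -/
theorem Polarization.exists_coe_mul_coe_eq_smul_one_of_mem_center_lefschetzSimilitudeGroupBaseChange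
    (hfix : ∀ z : H.endAlg, z ∈ Subalgebra.center ℚ H.endAlg → ψ.adjoint (z : Module.End ℚ V) = z)
    {γ : ψ.lefschetzSimilitudeGroupBaseChange K} (hγ : γ ∈ Subgroup.center (ψ.lefschetzSimilitudeGroupBaseChange K)) :
    ∃ ν : K, ν ≠ 0 ∧ ((γ : (K ⊗[ℚ] V) ≃ₗ[K] (K ⊗[ℚ] V)) : Module.End K (K ⊗[ℚ] V)) *
        ((γ : (K ⊗[ℚ] V) ≃ₗ[K] (K ⊗[ℚ] V)) : Module.End K (K ⊗[ℚ] V)) = ν • (1 : Module.End K (K ⊗[ℚ] V)) := by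
  obtain ⟨-, ν, hν, hνγ⟩ := (ψ.mem_lefschetzSimilitudeGroupBaseChange_iff_adjointBaseChange_mul_self_eq_smul K _).1 γ.2
  refine ⟨ν, hν, ?_⟩
  -- `↑γ ∈ Z(C(H)(K)) = C₀ ⊗ K`, hence `†_K`-fixed (g54-#6)
  have hz := (ψ.mem_center_lefschetzSimilitudeGroupBaseChange_iff_mem_center_centralizer K γ).1 hγ
  have hadj := (ψ.forall_center_adjointBaseChange_eq_self_iff K).2 hfix _ hz
  change ψ.adjointBaseChange K ((γ : (K ⊗[ℚ] V) ≃ₗ[K] (K ⊗[ℚ] V)) : Module.End K (K ⊗[ℚ] V)) =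
    ((γ : (K ⊗[ℚ] V) ≃ₗ[K] (K ⊗[ℚ] V)) : Module.End K (K ⊗[ℚ] V)) at hadj
  rw [hadj] at hνγ
  exact hνγ

end Points

/-! ## §2 Along `K → L`: `γ_L ∈ Z(G(H)(L)) ⟺ γ ∈ Z(G(H)(K))` -/

section Tower

variable (K : Type u) (L : Type u') [Field K] [Field L] [Algebra ℚ K] [Algebra ℚ L] [Algebra K L]
  [IsScalarTower ℚ K L] {V : Type v} [AddCommGroup V] [Module ℚ V] [Module.Finite ℚ V] {n : ℤ} {H : HodgeStructure V n}
  (ψ : Polarization H)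

omit [Module.Finite ℚ V] in
/-- The image spelling of `E_φ ⊗ K`. [folklore] -/
private theorem range_baseChange_endAlg_eq_image₅₆₈ :
    (Set.range fun a : H.endAlg => (a : Module.End ℚ V).baseChange K) =
      (fun z : Module.End ℚ V => z.baseChange K) '' (H.endAlg : Set (Module.End ℚ V)) := by
  rw [Set.image_eq_range]
  rfl

/-- **`γ ∈ Z(G(H)(K)) ⟹ γ_L ∈ Z(G(H)(L))`** (`↑γ ∈ E_φ ⊗ K` is carried by LEMMA A of g56-#1 to `↑γ_L ∈ E_φ ⊗ L`, and `γ_L ∈ G(H)(L)` by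
Remark 1.6 on points). [cite: Milne1999LefschetzClasses, §1 Remark 1.6 (p. 644) and §4 p. 659 L10–L20] -/
theorem Polarization.glExtendScalars_mem_center_lefschetzSimilitudeGroupBaseChange {γ : ψ.lefschetzSimilitudeGroupBaseChange K}
    (hγ : γ ∈ Subgroup.center (ψ.lefschetzSimilitudeGroupBaseChange K)) :
    (⟨glExtendScalars K L V (γ : (K ⊗[ℚ] V) ≃ₗ[K] (K ⊗[ℚ] V)),
        (ψ.glExtendScalars_mem_lefschetzSimilitudeGroupBaseChange_iff K L _).2 γ.2⟩ : ψ.lefschetzSimilitudeGroupBaseChange L) ∈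
      Subgroup.center (ψ.lefschetzSimilitudeGroupBaseChange L) := by
  rw [ψ.mem_center_lefschetzSimilitudeGroupBaseChange_iff_mem_span K, range_baseChange_endAlg_eq_image₅₆₈ K] at hγ
  rw [ψ.mem_center_lefschetzSimilitudeGroupBaseChange_iff_mem_span L, range_baseChange_endAlg_eq_image₅₆₈ L]
  exact mem_span_image_baseChange_of_extendScalars_comm K L V (coe_glExtendScalars_extendScalars K L V _) hγ

/-- **`γ_L ∈ Z(G(H)(L)) ⟺ γ ∈ Z(G(H)(K))`** («`S'(A) ≅ S(A)_{/k'}`»-type compatibility for the centre of `G(A)`; "⟹" by the injectivity of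
`γ ↦ γ_L`). [cite: Milne1999LefschetzClasses, §1 Remark 1.6 (p. 644) and §4 p. 659 L10–L20] -/
theorem Polarization.glExtendScalars_mem_center_lefschetzSimilitudeGroupBaseChange_iff (γ : ψ.lefschetzSimilitudeGroupBaseChange K) :
    (⟨glExtendScalars K L V (γ : (K ⊗[ℚ] V) ≃ₗ[K] (K ⊗[ℚ] V)),
        (ψ.glExtendScalars_mem_lefschetzSimilitudeGroupBaseChange_iff K L _).2 γ.2⟩ : ψ.lefschetzSimilitudeGroupBaseChange L) ∈
      Subgroup.center (ψ.lefschetzSimilitudeGroupBaseChange L) ↔ γ ∈ Subgroup.center (ψ.lefschetzSimilitudeGroupBaseChange K) := by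
  refine ⟨fun h => Subgroup.mem_center_iff.2 fun δ => ?_, ψ.glExtendScalars_mem_center_lefschetzSimilitudeGroupBaseChange K L⟩
  have hδ := Subgroup.mem_center_iff.1 h ⟨glExtendScalars K L V (δ : (K ⊗[ℚ] V) ≃ₗ[K] (K ⊗[ℚ] V)),
    (ψ.glExtendScalars_mem_lefschetzSimilitudeGroupBaseChange_iff K L _).2 δ.2⟩
  have hδ' := congrArg Subtype.val hδ
  simp only [Subgroup.coe_mul] at hδ'
  refine Subtype.ext (glExtendScalars_injective K L V ?_)
  rw [Subgroup.coe_mul, Subgroup.coe_mul]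
  simpa only [← glExtendScalarsHom_apply, map_mul] using hδ'

/-- **`Z(G(H)(K))` = the preimage of `Z(G(H)(L))` under `G(H)(K) → G(H)(L)`, `γ ↦ γ_L`.** [cite: Milne1999LefschetzClasses, §1 Remark 1.6 (p. 644) and §4 p. 659 L10–L20] -/
theorem Polarization.comap_center_lefschetzSimilitudeGroupBaseChange_eq_center :
    (Subgroup.center (ψ.lefschetzSimilitudeGroupBaseChange L)).comap
        (((glExtendScalarsHom K L V).restrict (ψ.lefschetzSimilitudeGroupBaseChange K)).codRestrict
          (ψ.lefschetzSimilitudeGroupBaseChange L)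
          fun γ => (ψ.glExtendScalars_mem_lefschetzSimilitudeGroupBaseChange_iff K L _).2 γ.2) =
      Subgroup.center (ψ.lefschetzSimilitudeGroupBaseChange K) := by
  ext γ
  rw [Subgroup.mem_comap]
  exact ψ.glExtendScalars_mem_center_lefschetzSimilitudeGroupBaseChange_iff K L γ

/-- **THE INJECTIVE HOMOMORPHISM `Z(G(H)(K)) →* Z(G(H)(L))` OVER `γ ↦ γ_L`.** [cite: Milne1999LefschetzClasses, §1 Remark 1.6 (p. 644) and §4 p. 659 L10–L20] -/
theorem Polarization.exists_center_lefschetzSimilitudeGroupBaseChange_monoidHom_injective :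
    ∃ f : Subgroup.center (ψ.lefschetzSimilitudeGroupBaseChange K) →* Subgroup.center (ψ.lefschetzSimilitudeGroupBaseChange L),
      Function.Injective f ∧ ∀ γ : Subgroup.center (ψ.lefschetzSimilitudeGroupBaseChange K),
        (((f γ : Subgroup.center (ψ.lefschetzSimilitudeGroupBaseChange L)) : ψ.lefschetzSimilitudeGroupBaseChange L) :
            (L ⊗[ℚ] V) ≃ₗ[L] (L ⊗[ℚ] V)) =
          glExtendScalars K L V ((γ : ψ.lefschetzSimilitudeGroupBaseChange K) : (K ⊗[ℚ] V) ≃ₗ[K] (K ⊗[ℚ] V)) := by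
  refine ⟨{ toFun := fun γ => ⟨_, ψ.glExtendScalars_mem_center_lefschetzSimilitudeGroupBaseChange K L γ.2⟩,
            map_one' := Subtype.ext (Subtype.ext ?_),
            map_mul' := fun γ γ' => Subtype.ext (Subtype.ext ?_) }, fun γ γ' h => ?_, fun γ => rfl⟩
  · change glExtendScalars K L V 1 = 1
    rw [← glExtendScalarsHom_apply, map_one]
  · change glExtendScalars K L V (((γ : ψ.lefschetzSimilitudeGroupBaseChange K) : (K ⊗[ℚ] V) ≃ₗ[K] (K ⊗[ℚ] V)) *
        ((γ' : ψ.lefschetzSimilitudeGroupBaseChange K) : (K ⊗[ℚ] V) ≃ₗ[K] (K ⊗[ℚ] V))) =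
      glExtendScalars K L V ((γ : ψ.lefschetzSimilitudeGroupBaseChange K) : (K ⊗[ℚ] V) ≃ₗ[K] (K ⊗[ℚ] V)) *
        glExtendScalars K L V ((γ' : ψ.lefschetzSimilitudeGroupBaseChange K) : (K ⊗[ℚ] V) ≃ₗ[K] (K ⊗[ℚ] V))
    rw [← glExtendScalarsHom_apply, map_mul, glExtendScalarsHom_apply, glExtendScalarsHom_apply]
  · have h1 := congrArg (fun x : Subgroup.center (ψ.lefschetzSimilitudeGroupBaseChange L) =>
      ((x : ψ.lefschetzSimilitudeGroupBaseChange L) : (L ⊗[ℚ] V) ≃ₗ[L] (L ⊗[ℚ] V))) h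
    exact Subtype.ext (Subtype.ext (glExtendScalars_injective K L V h1))

end Tower

end HodgeStructure

end Literature.AlgebraicGeometry.Motives
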